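import Summits.ValiantsHypothesis.ValiantsHypothesis.Theorems.BarrierLeverChowHitsPartitionMinorsRFacePrivatePrelims

/-!
# Route BarrierLever — item `ChowHitsPartitionMinorsR` (stmt-ValiantsHypothesis-21882):
# the face-private design — COLUMN STRUCTURE of a product of groups

Helper file (`--supports stmt-ValiantsHypothesis-21882`; cell valiant-natproofs, rung V4, 𝒟-side
support item of route BarrierLever; prover seat val-np-p5 gen 29). Definition-free. Closes NO item.
Second file of the kernel form of THEOREM FP (seat memo MEMO-21882-valnp5-g29.md §6).

ABSTRACT SETTING. A finite family of «groups» `G i` (`i : ι`) of polynomials in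
`MvPolynomial (Fin (h+h)) R` with «pure parts» `Q i` and pairwise distinct nonempty «column sets»
`W i ⊆ Fin h`, such that, on partition exponents `E S T = Σ_{a∈S} single (castAdd a) 1 +
Σ_{c∈T} single (natAdd c) 1`,
* `coeff (E S T) (Q i) = 0` whenever `T ≠ ∅` (the pure part is `x`-only on square-free exponents), and
* `coeff (E S T) (G i) = coeff (E S T) (Q i) + [S = ∅ ∧ T = W i] · t · c i` for a fixed scalar `t`
(this is what `ChowFacePrivate.coeff_partitionExpo_rootGroup` provides for the root-of-unity groups
`∏_{k<n} (1 − X_{σ(i)} + ζ^k s_i Y_{W i})`, with `Q i = (1 − X_{σ(i)})^{|W i|}` and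
`t · c i = −(−s_i)^{|W i|} |W i|!`).

RESULTS (all by induction on the set of groups with the convolution formula
`BiadditiveDoor.coeff_partitionExpo_mul`):
* `dvd_coeff_prod_group` — every partition coefficient of `∏_{i∈I} G i` at `(U, T)` with `T ≠ ∅` is a
  multiple of `t`, and a multiple of `t²` unless `T` is one of the column sets `W i`, `i ∈ I`;
* `coeff_prod_group_empty` — at `(U, ∅)` the product of groups and the product of pure parts agree;
* **`coeff_prod_group_column`** — THE COLUMN STRUCTURE: for `j ∈ I`,
  `coeff (E U (W j)) (∏_{i∈I} G i) = t · c j · coeff (E U ∅) (∏_{i ∈ I∖j} Q i) + t² · (…)`.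
So the partition matrix of the product on the columns `W j` is `t · [c_j a_j] + O(t²)` with
`a_j(U) = coeff (E U ∅) ∏_{i≠j} Q i` — the leading matrix whose determinant the files
`…FacePrivateLeading` / `…FacePrivateDesign` show to be nonzero for the root-of-unity groups on a
lower-set row family.

WHAT THIS IS NOT: no statement about item 21882 yet; nothing on crux stmt-ValiantsHypothesis-14610
or on `VP` versus `VNP`.
-/

set_option linter.dupNamespace false

namespace Summit.ValiantsHypothesis.ValiantsHypothesis.Theorems.BarrierLever.ChowFacePrivate

open Finset MvPolynomial
open Summit.ValiantsHypothesis.ValiantsHypothesis.Theorems.BarrierLever.BiadditiveDoor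
  (coeff_partitionExpo_mul)
open Summit.ValiantsHypothesis.ValiantsHypothesis.Theorems.BarrierLever.ChowFactor
  (coeff_partitionExpo_one)

noncomputable section

variable {h : ℕ} {R : Type*} [CommRing R] {ι : Type*} [DecidableEq ι]

/-- **Divisibility invariant.** For a product of groups, every partition coefficient at `(U, T)` with
`T ≠ ∅` is a multiple of `t`, and a multiple of `t²` unless `T` is one of the column sets of the
groups in the product. -/
theorem dvd_coeff_prod_group (G Q : ι → MvPolynomial (Fin (h + h)) R) (W : ι → Finset (Fin h))
    (c : ι → R) (t : R)
    (hQ : ∀ (i : ι) (S T : Finset (Fin h)), T ≠ ∅ →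
      coeff (∑ a ∈ S, Finsupp.single (Fin.castAdd h a) 1 + ∑ c ∈ T, Finsupp.single (Fin.natAdd h c) 1)
        (Q i) = 0)
    (hG : ∀ (i : ι) (S T : Finset (Fin h)),
      coeff (∑ a ∈ S, Finsupp.single (Fin.castAdd h a) 1 + ∑ c ∈ T, Finsupp.single (Fin.natAdd h c) 1)
        (G i) =
      coeff (∑ a ∈ S, Finsupp.single (Fin.castAdd h a) 1 + ∑ c ∈ T, Finsupp.single (Fin.natAdd h c) 1)
        (Q i) + (if S = ∅ ∧ T = W i then t * c i else 0))
    (hW : ∀ i, W i ≠ ∅) :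
    ∀ (I : Finset ι) (U T : Finset (Fin h)), T ≠ ∅ →
      (t ∣ coeff (∑ a ∈ U, Finsupp.single (Fin.castAdd h a) 1 +
          ∑ c ∈ T, Finsupp.single (Fin.natAdd h c) 1) (∏ i ∈ I, G i)) ∧
      ((∀ i ∈ I, W i ≠ T) → t * t ∣ coeff (∑ a ∈ U, Finsupp.single (Fin.castAdd h a) 1 +
          ∑ c ∈ T, Finsupp.single (Fin.natAdd h c) 1) (∏ i ∈ I, G i)) := by
  classical
  intro I
  induction I using Finset.induction_on with
  | empty =>
    intro U T hT
    rw [Finset.prod_empty, coeff_partitionExpo_one R, if_neg (fun hh => hT hh.2)]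
    exact ⟨dvd_zero _, fun _ => dvd_zero _⟩
  | @insert i I hi ih =>
    intro U T hT
    rw [Finset.prod_insert hi, mul_comm, coeff_partitionExpo_mul]
    -- each term of the convolution: `κ_{∏ I} (S, T') · κ_{G i} (U \ S, T \ T')`
    have hterm : ∀ S ∈ U.powerset, ∀ T' ∈ T.powerset,
        (t ∣ coeff (∑ a ∈ S, Finsupp.single (Fin.castAdd h a) 1 +
            ∑ c ∈ T', Finsupp.single (Fin.natAdd h c) 1) (∏ i ∈ I, G i) *
          coeff (∑ a ∈ U \ S, Finsupp.single (Fin.castAdd h a) 1 +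
            ∑ c ∈ T \ T', Finsupp.single (Fin.natAdd h c) 1) (G i)) ∧
        ((∀ i' ∈ insert i I, W i' ≠ T) → t * t ∣
          coeff (∑ a ∈ S, Finsupp.single (Fin.castAdd h a) 1 +
            ∑ c ∈ T', Finsupp.single (Fin.natAdd h c) 1) (∏ i ∈ I, G i) *
          coeff (∑ a ∈ U \ S, Finsupp.single (Fin.castAdd h a) 1 +
            ∑ c ∈ T \ T', Finsupp.single (Fin.natAdd h c) 1) (G i)) := by
      intro S _ T' hT'
      rw [Finset.mem_powerset] at hT'
      rw [hG]
      by_cases hTT' : T' = T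
      · -- `T \ T' = ∅`: the group contributes its pure part, the prefix carries the divisibility
        rw [hTT', Finset.sdiff_self, if_neg (fun hh => hW i hh.2.symm), add_zero]
        obtain ⟨h₁, h₂⟩ := ih S T hT
        exact ⟨h₁.mul_right _, fun hall =>
          (h₂ (fun i' hi' => hall i' (Finset.mem_insert_of_mem hi'))).mul_right _⟩
      · -- `T \ T' ≠ ∅`: the pure part vanishes there
        have hne : T \ T' ≠ ∅ := by
          intro e
          exact hTT' (Finset.Subset.antisymm hT' (Finset.sdiff_eq_empty_iff_subset.mp e))
        rw [hQ i _ _ hne, zero_add]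
        by_cases hc : U \ S = ∅ ∧ T \ T' = W i
        · rw [if_pos hc]
          by_cases hT'e : T' = ∅
          · -- then `T = W i`: divisible by `t`; the `t²` claim is vacuous
            refine ⟨(dvd_mul_right t (c i)).mul_left _, fun hall => ?_⟩
            exfalso
            rw [hT'e, Finset.sdiff_empty] at hc
            exact hall i (Finset.mem_insert_self i I) hc.2.symm
          · obtain ⟨h₁, -⟩ := ih S T' hT'e
            have h2 : t * t ∣ coeff (∑ a ∈ S, Finsupp.single (Fin.castAdd h a) 1 +
                ∑ c ∈ T', Finsupp.single (Fin.natAdd h c) 1) (∏ i ∈ I, G i) * (t * c i) := by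
              rw [mul_comm t (c i), ← mul_assoc]
              exact mul_dvd_mul (h₁.mul_right _) (dvd_refl t)
            exact ⟨(dvd_mul_right t (c i)).mul_left _, fun _ => h2⟩
        · rw [if_neg hc, mul_zero]
          exact ⟨dvd_zero _, fun _ => dvd_zero _⟩
    exact ⟨Finset.dvd_sum fun S hS => Finset.dvd_sum fun T' hT' => (hterm S hS T' hT').1,
      fun hall => Finset.dvd_sum fun S hS => Finset.dvd_sum fun T' hT' => (hterm S hS T' hT').2 hall⟩

/-- **At the empty column the groups and their pure parts agree.** -/
theorem coeff_prod_group_empty (G Q : ι → MvPolynomial (Fin (h + h)) R) (W : ι → Finset (Fin h))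
    (c : ι → R) (t : R)
    (hG : ∀ (i : ι) (S T : Finset (Fin h)),
      coeff (∑ a ∈ S, Finsupp.single (Fin.castAdd h a) 1 + ∑ c ∈ T, Finsupp.single (Fin.natAdd h c) 1)
        (G i) =
      coeff (∑ a ∈ S, Finsupp.single (Fin.castAdd h a) 1 + ∑ c ∈ T, Finsupp.single (Fin.natAdd h c) 1)
        (Q i) + (if S = ∅ ∧ T = W i then t * c i else 0))
    (hW : ∀ i, W i ≠ ∅) :
    ∀ (I : Finset ι) (U : Finset (Fin h)),
      coeff (∑ a ∈ U, Finsupp.single (Fin.castAdd h a) 1 +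
          ∑ c ∈ (∅ : Finset (Fin h)), Finsupp.single (Fin.natAdd h c) 1) (∏ i ∈ I, G i) =
      coeff (∑ a ∈ U, Finsupp.single (Fin.castAdd h a) 1 +
          ∑ c ∈ (∅ : Finset (Fin h)), Finsupp.single (Fin.natAdd h c) 1) (∏ i ∈ I, Q i) := by
  classical
  intro I
  induction I using Finset.induction_on with
  | empty => intro U; rw [Finset.prod_empty, Finset.prod_empty]
  | @insert i I hi ih =>
    intro U
    rw [Finset.prod_insert hi, Finset.prod_insert hi, mul_comm (G i), mul_comm (Q i),
      coeff_partitionExpo_mul, coeff_partitionExpo_mul]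
    refine Finset.sum_congr rfl fun S _ => ?_
    rw [Finset.powerset_empty, Finset.sum_singleton, Finset.sum_singleton, Finset.sdiff_self, ih S,
      hG, if_neg (fun hh => hW i hh.2.symm), add_zero]

/-- **THE COLUMN STRUCTURE.** For `j ∈ I`, the partition coefficient of `∏_{i∈I} G i` at `(U, W j)`
is `t · c j · coeff (E U ∅) (∏_{i∈I∖j} Q i)` up to a multiple of `t²`. -/
theorem coeff_prod_group_column (G Q : ι → MvPolynomial (Fin (h + h)) R) (W : ι → Finset (Fin h))
    (c : ι → R) (t : R)
    (hQ : ∀ (i : ι) (S T : Finset (Fin h)), T ≠ ∅ →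
      coeff (∑ a ∈ S, Finsupp.single (Fin.castAdd h a) 1 + ∑ c ∈ T, Finsupp.single (Fin.natAdd h c) 1)
        (Q i) = 0)
    (hG : ∀ (i : ι) (S T : Finset (Fin h)),
      coeff (∑ a ∈ S, Finsupp.single (Fin.castAdd h a) 1 + ∑ c ∈ T, Finsupp.single (Fin.natAdd h c) 1)
        (G i) =
      coeff (∑ a ∈ S, Finsupp.single (Fin.castAdd h a) 1 + ∑ c ∈ T, Finsupp.single (Fin.natAdd h c) 1)
        (Q i) + (if S = ∅ ∧ T = W i then t * c i else 0))
    (hW : ∀ i, W i ≠ ∅) (hWinj : Function.Injective W)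
    (I : Finset ι) (j : ι) (hj : j ∈ I) (U : Finset (Fin h)) :
    ∃ r : R, coeff (∑ a ∈ U, Finsupp.single (Fin.castAdd h a) 1 +
        ∑ c ∈ W j, Finsupp.single (Fin.natAdd h c) 1) (∏ i ∈ I, G i) =
      t * c j * coeff (∑ a ∈ U, Finsupp.single (Fin.castAdd h a) 1 +
        ∑ c ∈ (∅ : Finset (Fin h)), Finsupp.single (Fin.natAdd h c) 1) (∏ i ∈ I.erase j, Q i) +
      t * t * r := by
  classical
  -- the main term
  set a : R := coeff (∑ a ∈ U, Finsupp.single (Fin.castAdd h a) 1 +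
      ∑ c ∈ (∅ : Finset (Fin h)), Finsupp.single (Fin.natAdd h c) 1) (∏ i ∈ I.erase j, Q i) with ha
  -- every term of the convolution, minus the main term at `(∅, W j)`, is a multiple of `t²`
  have hterm : ∀ S ∈ U.powerset, ∀ T' ∈ (W j).powerset,
      t * t ∣ coeff (∑ a ∈ S, Finsupp.single (Fin.castAdd h a) 1 +
          ∑ c ∈ T', Finsupp.single (Fin.natAdd h c) 1) (G j) *
        coeff (∑ a ∈ U \ S, Finsupp.single (Fin.castAdd h a) 1 +
          ∑ c ∈ W j \ T', Finsupp.single (Fin.natAdd h c) 1) (∏ i ∈ I.erase j, G i) -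
        (if S = ∅ ∧ T' = W j then t * c j * a else 0) := by
    intro S hS T' hT'
    rw [Finset.mem_powerset] at hS hT'
    rw [hG]
    by_cases hT'e : T' = ∅
    · rw [hT'e, if_neg (fun hh => hW j hh.2.symm), add_zero, Finset.sdiff_empty,
        if_neg (fun hh => hW j hh.2.symm), sub_zero]
      -- `κ_{∏ erase} (U \ S, W j)` is a multiple of `t²` (`W j` is not a column of the others)
      exact ((dvd_coeff_prod_group G Q W c t hQ hG hW (I.erase j) (U \ S) (W j) (hW j)).2
        (fun i hi e => (Finset.ne_of_mem_erase hi) (hWinj e))).mul_left _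
    · rw [hQ j _ _ hT'e, zero_add]
      by_cases hc : S = ∅ ∧ T' = W j
      · obtain ⟨rfl, rfl⟩ := hc
        rw [if_pos ⟨rfl, rfl⟩, if_pos ⟨rfl, rfl⟩, Finset.sdiff_empty, Finset.sdiff_self, ha,
          coeff_prod_group_empty G Q W c t hG hW (I.erase j) U, sub_self]
        exact dvd_zero _
      · rw [if_neg hc, if_neg hc, zero_mul, sub_zero]
        exact dvd_zero _
  have hsum := Finset.dvd_sum fun S hS => Finset.dvd_sum fun T' hT' => hterm S hS T' hT'
  simp only [Finset.sum_sub_distrib] at hsum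
  -- the sum of the indicators is the main term
  have hind : ∑ S ∈ U.powerset, ∑ T' ∈ (W j).powerset,
      (if S = ∅ ∧ T' = W j then t * c j * a else 0) = t * c j * a := by
    rw [Finset.sum_eq_single ∅]
    · rw [Finset.sum_eq_single (W j)]
      · rw [if_pos ⟨rfl, rfl⟩]
      · intro T' _ hT'; rw [if_neg (fun hh => hT' hh.2)]
      · intro hWj; exact absurd (Finset.mem_powerset_self _) hWj
    · intro S _ hS
      exact Finset.sum_eq_zero fun T' _ => by rw [if_neg (fun hh => hS hh.1)]
    · intro hU; exact absurd (Finset.empty_mem_powerset U) hU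
  rw [hind] at hsum
  obtain ⟨r, hr⟩ := hsum
  refine ⟨r, ?_⟩
  rw [← Finset.mul_prod_erase I G hj, coeff_partitionExpo_mul]
  rw [sub_eq_iff_eq_add'] at hr
  rw [hr]

end

end Summit.ValiantsHypothesis.ValiantsHypothesis.Theorems.BarrierLever.ChowFacePrivate
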